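import Summits.HodgeConjecture.HodgeConjecture.Theorems.Ring2WeilCoverageTraceGramDeterminant
import Mathlib.LinearAlgebra.Matrix.Block
import HarnessLib

/-!
# Weil-type family coverage — Gram determinants at `g = 10, 12`: a CERTIFICATE RULE for determinants (row-permuted
# `P·A = U` with triangular `P`, `U`, checked by `decide`) and the generic evaluation step `Tr(y·θ^m) = coeff_d(R)`

research route conditional on HC_CM; not a corollary; Q11.4-sentence-2 already refuted in dim ≥ 3.

Ring 2, WEIL-TYPE FAMILY-COVERAGE CENSUS (`HOME/WEIL-FAMILY-COVERAGE.md` `## b01`, blocks b01.41 (C), b01.47/48 (E)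
«NEXT: the `g = 10/12` placements (33/44/35/45) need a certificate-style determinant (LU) instead of Laplace»; owner
ring2-b01), part 119 of the `Ring2WeilCoverage*` series — level-free tools for the tenfold/twelvefold Gram files:

* §1 **`det_eq_of_certificate`**: if `P·A[σ] = U` (`A[σ] i j = A (σ i) j` a row permutation; `P` lower triangular,
  `U` upper triangular) then `det A = D` for the `D` with `(∏ P i i)·sign σ·D = ∏ U i i` — the LU certificate of a
  `10 × 10` / `12 × 12` integer matrix is three matrix literals and six `decide`s (Laplace expansion, used at `g ≤ 6`,
  has `g!` terms).
* §2 the evaluation step of parts 83/87/98 made level-free: for `φ(M) = d + 1`, `Tr_{K/ℚ}(y·θ^m) = coeff_d(R)` from a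
  certificate `y(ζ² + 1)^m = R(ζ)Φ_M′(ζ)⁻¹ζ^m`, `θ = ζ + ζ⁻¹`, `deg R ≤ d` (part 81, Euler), and the evaluation of an
  explicit polynomial of degree `≤ 19` / `≤ 23` at `ζ` (`aeval_poly₂₀`, `aeval_poly₂₄`).

HONEST FRAMING: elementary linear algebra and the Euler trace formula; nothing about Hodge classes or HC; `HC_CM` is
used nowhere.  No `def`, no named fact, no `sorry`.

References: [cite: NeukirchANT1999, Ch. III (2.4)] (Euler); [folklore] (LU certificates).
-/

noncomputable section

open Polynomial Matrix Equiv

namespace Summit.HodgeConjecture.Ring2WeilCoverage.WeilGramTools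

open Summit.HodgeConjecture.Ring2WeilCoverage.TraceGramDeterminant (trace_aeval_zeta_mul_inv)

/-! ### §1 The certificate rule for a determinant -/

/-- **Certificate rule.** If `P * A.submatrix σ id = U` with `P` lower triangular and `U` upper triangular, then
`det A = D` for the (unique) `D` with `(∏ P i i)·sign σ·D = ∏ U i i` (`∏ P i i ≠ 0`).  Usage: `P`, `U`, `σ`, `sign σ`
from an exact LU factorisation with partial pivoting; all six hypotheses by `decide +kernel`. [folklore] -/
theorem det_eq_of_certificate {n : ℕ} {R : Type*} [CommRing R] [IsDomain R] {A : Matrix (Fin n) (Fin n) R}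
    (P U : Matrix (Fin n) (Fin n) R) (σ : Perm (Fin n)) (s : ℤˣ) (D : R)
    (h : P * A.submatrix ⇑σ id = U) (hP : ∀ i j, i < j → P i j = 0) (hU : ∀ i j, j < i → U i j = 0)
    (hs : Perm.sign σ = s) (hD : (∏ i, P i i) * (s : ℤ) * D = ∏ i, U i i) (h0 : (∏ i, P i i) ≠ 0) : A.det = D := by
  have h' := congrArg Matrix.det h
  rw [det_mul, det_permute, hs, det_of_lowerTriangular P (fun i j hij => hP i j hij),
    det_of_upperTriangular (fun i j hij => hU i j hij), ← hD, mul_assoc] at h'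
  have hs0 : ((s : ℤ) : R) ≠ 0 := by
    rcases Int.units_eq_one_or s with rfl | rfl <;> simp
  exact mul_left_cancel₀ hs0 (mul_left_cancel₀ h0 h')

/-! ### §2 The evaluation step at a cyclotomic level with `φ(M) = d + 1` -/

variable {K : Type} [Field K] [NumberField K] {M : ℕ} [NeZero M] {ζ : K}

omit [NumberField K] [NeZero M] in
/-- `θζ = ζ² + 1` for `θ = ζ + ζ⁻¹`, `ζ ≠ 0`. [folklore] -/
theorem theta_mul_zeta_of_ne_zero (hζ0 : ζ ≠ 0) : (ζ + ζ⁻¹) * ζ = ζ ^ 2 + 1 := by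
  rw [add_mul, inv_mul_cancel₀ hζ0]
  ring

/-- `Tr_{K/ℚ}(y) = coeff_d(R)` if `y = R(ζ)/Φ_M′(ζ)` with `deg R ≤ d`, `φ(M) = d + 1` (part 81 `trace_aeval_zeta_mul_inv`).
research route conditional on HC_CM; not a corollary; Q11.4-sentence-2 already refuted in dim ≥ 3. [cite: NeukirchANT1999, Ch. III (2.4) Proposition] -/
theorem trace_of_key₀ [IsCyclotomicExtension {M} ℚ K] (hζ : IsPrimitiveRoot ζ M) {d : ℕ} (hφ : Nat.totient M = d + 1)
    {y : K} (R : ℚ[X]) (hR : R.natDegree ≤ d) (hkey : y = aeval ζ R * (aeval ζ (derivative (cyclotomic M ℚ)))⁻¹) :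
    Algebra.trace ℚ K y = R.coeff d := by
  rw [hkey, trace_aeval_zeta_mul_inv hζ R (by rw [hφ]; omega), hφ, Nat.add_sub_cancel]

/-- `Tr_{K/ℚ}(y·θ) = coeff_d(R)` if `y(ζ² + 1) = R(ζ)Φ_M′(ζ)⁻¹·ζ` (`θζ = ζ² + 1`). research route conditional on HC_CM; not a corollary; Q11.4-sentence-2 already refuted in dim ≥ 3. [cite: NeukirchANT1999, Ch. III (2.4) Proposition] -/
theorem trace_of_key₁ [IsCyclotomicExtension {M} ℚ K] (hζ : IsPrimitiveRoot ζ M) {d : ℕ} (hφ : Nat.totient M = d + 1)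
    {y : K} (R : ℚ[X]) (hR : R.natDegree ≤ d)
    (hkey : y * (ζ ^ 2 + 1) = aeval ζ R * (aeval ζ (derivative (cyclotomic M ℚ)))⁻¹ * ζ) :
    Algebra.trace ℚ K (y * (ζ + ζ⁻¹)) = R.coeff d := by
  have hζ0 : ζ ≠ 0 := hζ.ne_zero (NeZero.ne M)
  refine trace_of_key₀ hζ hφ R hR (mul_right_cancel₀ hζ0 ?_)
  rw [mul_assoc, theta_mul_zeta_of_ne_zero hζ0, hkey]

/-- `Tr_{K/ℚ}(y·θ^m) = coeff_d(R)` if `y(ζ² + 1)^m = R(ζ)Φ_M′(ζ)⁻¹·ζ^m` (`θ^m ζ^m = (ζ² + 1)^m`). research route conditional on HC_CM; not a corollary; Q11.4-sentence-2 already refuted in dim ≥ 3. [cite: NeukirchANT1999, Ch. III (2.4) Proposition] -/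
theorem trace_of_key [IsCyclotomicExtension {M} ℚ K] (hζ : IsPrimitiveRoot ζ M) {d : ℕ} (hφ : Nat.totient M = d + 1)
    {y : K} {m : ℕ} (R : ℚ[X]) (hR : R.natDegree ≤ d)
    (hkey : y * (ζ ^ 2 + 1) ^ m = aeval ζ R * (aeval ζ (derivative (cyclotomic M ℚ)))⁻¹ * ζ ^ m) :
    Algebra.trace ℚ K (y * (ζ + ζ⁻¹) ^ m) = R.coeff d := by
  have hζ0 : ζ ≠ 0 := hζ.ne_zero (NeZero.ne M)
  refine trace_of_key₀ hζ hφ R hR (mul_right_cancel₀ (pow_ne_zero m hζ0) ?_)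
  rw [mul_assoc, ← mul_pow, theta_mul_zeta_of_ne_zero hζ0, hkey]

/-- Evaluation of an explicit polynomial of degree `≤ 19` at `ζ` (the `R` of the evaluation step at `φ(M) = 20`). [folklore] -/
theorem aeval_poly₂₀ (ζ : K) (c₀ c₁ c₂ c₃ c₄ c₅ c₆ c₇ c₈ c₉ c₁₀ c₁₁ c₁₂ c₁₃ c₁₄ c₁₅ c₁₆ c₁₇ c₁₈ c₁₉ : ℚ) :
    aeval ζ (C c₀ + C c₁ * X + C c₂ * X ^ 2 + C c₃ * X ^ 3 + C c₄ * X ^ 4 + C c₅ * X ^ 5 + C c₆ * X ^ 6 + C c₇ * X ^ 7 +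
      C c₈ * X ^ 8 + C c₉ * X ^ 9 + C c₁₀ * X ^ 10 + C c₁₁ * X ^ 11 + C c₁₂ * X ^ 12 + C c₁₃ * X ^ 13 +
      C c₁₄ * X ^ 14 + C c₁₅ * X ^ 15 + C c₁₆ * X ^ 16 + C c₁₇ * X ^ 17 + C c₁₈ * X ^ 18 + C c₁₉ * X ^ 19) =
      (c₀ : K) + (c₁ : K) * ζ + (c₂ : K) * ζ ^ 2 + (c₃ : K) * ζ ^ 3 + (c₄ : K) * ζ ^ 4 + (c₅ : K) * ζ ^ 5 +
        (c₆ : K) * ζ ^ 6 + (c₇ : K) * ζ ^ 7 + (c₈ : K) * ζ ^ 8 + (c₉ : K) * ζ ^ 9 + (c₁₀ : K) * ζ ^ 10 +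
        (c₁₁ : K) * ζ ^ 11 + (c₁₂ : K) * ζ ^ 12 + (c₁₃ : K) * ζ ^ 13 + (c₁₄ : K) * ζ ^ 14 + (c₁₅ : K) * ζ ^ 15 +
        (c₁₆ : K) * ζ ^ 16 + (c₁₇ : K) * ζ ^ 17 + (c₁₈ : K) * ζ ^ 18 + (c₁₉ : K) * ζ ^ 19 := by
  simp only [map_add, map_mul, map_pow, aeval_C, aeval_X, eq_ratCast]

/-- Evaluation of an explicit polynomial of degree `≤ 23` at `ζ` (the `R` of the evaluation step at `φ(M) = 24`). [folklore] -/
theorem aeval_poly₂₄ (ζ : K) (c₀ c₁ c₂ c₃ c₄ c₅ c₆ c₇ c₈ c₉ c₁₀ c₁₁ c₁₂ c₁₃ c₁₄ c₁₅ c₁₆ c₁₇ c₁₈ c₁₉ c₂₀ c₂₁ c₂₂ c₂₃ : ℚ) :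
    aeval ζ (C c₀ + C c₁ * X + C c₂ * X ^ 2 + C c₃ * X ^ 3 + C c₄ * X ^ 4 + C c₅ * X ^ 5 + C c₆ * X ^ 6 + C c₇ * X ^ 7 +
      C c₈ * X ^ 8 + C c₉ * X ^ 9 + C c₁₀ * X ^ 10 + C c₁₁ * X ^ 11 + C c₁₂ * X ^ 12 + C c₁₃ * X ^ 13 +
      C c₁₄ * X ^ 14 + C c₁₅ * X ^ 15 + C c₁₆ * X ^ 16 + C c₁₇ * X ^ 17 + C c₁₈ * X ^ 18 + C c₁₉ * X ^ 19 +
      C c₂₀ * X ^ 20 + C c₂₁ * X ^ 21 + C c₂₂ * X ^ 22 + C c₂₃ * X ^ 23) =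
      (c₀ : K) + (c₁ : K) * ζ + (c₂ : K) * ζ ^ 2 + (c₃ : K) * ζ ^ 3 + (c₄ : K) * ζ ^ 4 + (c₅ : K) * ζ ^ 5 +
        (c₆ : K) * ζ ^ 6 + (c₇ : K) * ζ ^ 7 + (c₈ : K) * ζ ^ 8 + (c₉ : K) * ζ ^ 9 + (c₁₀ : K) * ζ ^ 10 +
        (c₁₁ : K) * ζ ^ 11 + (c₁₂ : K) * ζ ^ 12 + (c₁₃ : K) * ζ ^ 13 + (c₁₄ : K) * ζ ^ 14 + (c₁₅ : K) * ζ ^ 15 +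
        (c₁₆ : K) * ζ ^ 16 + (c₁₇ : K) * ζ ^ 17 + (c₁₈ : K) * ζ ^ 18 + (c₁₉ : K) * ζ ^ 19 + (c₂₀ : K) * ζ ^ 20 +
        (c₂₁ : K) * ζ ^ 21 + (c₂₂ : K) * ζ ^ 22 + (c₂₃ : K) * ζ ^ 23 := by
  simp only [map_add, map_mul, map_pow, aeval_C, aeval_X, eq_ratCast]

end Summit.HodgeConjecture.Ring2WeilCoverage.WeilGramTools

end
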